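import Summits.QuantumFields.BalabanUV.T4Continuum.Support.B13StepOfRecordSecantStructuralSub
import Summits.QuantumFields.BalabanUV.T4Continuum.Support.B13StepOfRecordSecantStructuralWitness
import Summits.QuantumFields.BalabanUV.T4Continuum.Support.B13StepEnvelopeEndSubWitness

/-!
# NE5 ∕ U3 — NON-VACUITY OF E8[rec] RE-POINTED OVER A SUB-SLOT (row owner's RULING R20 (i)): the structural secant END of record
# WITH THE R20 CAVEAT LIFTED, `B13StepOfRecordSecantStructuralSub.ne5_of_record_restrict_secant_structural`, FIRES on Bałaban's carriers
# of record for leaf-10's ZERO slot package RESTRICTED TO **EVERY** sub-slot `M ≤ OpDatum Unit` (operator lines `p.1 + ζ•u`, `u ∈ M`;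
# the binders `hfib`∕`hexp`∕`hN`∕`habs` now live on `↥M × ℂ`) — and so do its `ActOpIntegral` and `ActOpLineAnalyticOn` companions

Cell `pub-balaban`, unit `b2b-balaban-t4-ne5-formalise-leaf-01` (NE5 formalisation swarm, LEAF PROVER 01, gen 7; journal INTENT l.12740;
the «optional follow-up» booked in this lineage's HANDOFF at the gen-6 close).  Companion of this lineage's
`Support/B13StepOfRecordSecantStructuralSub.lean` p217039 in the pattern of its `Support/B13StepOfRecordSecantStructuralWitness.lean` p214898
(E8[rec]) and of leaf-03's `Support/B13StepEnvelopeEndSubWitness.lean` p217231 (E9[rec]-sub), whose `zeroActDataOn`,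
`actExpLinearOn_restrict_zero`, `actOpLineAnalyticOn_restrict_zero`, `actNormBound_restrict_zero` and leaf-10's record-level zero lemmas
(`B13StepEndWitness`) are consumed BY NAME.  Summits-side NEW WORK under the LEAN PLACEMENT RULE (cell bookkeeping; NOT a Literature
module; 0 `def`, 0 hypothesis shape, 0 cite tag).  HONEST FRAMING: rung (B)+1 of the FINITE-VOLUME T⁴ continuum programme — NOT infinite
volume, NOT a mass gap, NOT the Clay problem, NOT a proof of NE5: a CONSISTENCY WITNESS for the displayed binder list of the re-pointed END
(the sub-slot ball class, the cores of record read through `M.subtypeL`, activity data over `↥M`, W1 along the reading) — it says NOTHING about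
Bałaban's (2.14) activities, his kernels or insertions; NOT progress on [Balaban1988RG2Cluster]'s objects (trigger c5).  HONEST DEPENDENCY
(cell line, verbatim): continuum YM on T⁴ ⇐ BetaPertH ∧ nine spine estimates (0/9 proved); BetaPertH ⇐ (D1) ∧ (D4) ∧ CAP+tail; G-an2-4
gates asym, D1 and NE2/3/4.

WHAT IS PROVED (kernel; `[folklore]`).  §0 the zero package's operator data of record ARE the zero datum (`assemble_zero`, `opOf_rawA_zero`,
`opOf_rawB_zero`), hence lie in EVERY ℂ-submodule `M ≤ OpDatum Unit` (`opA_mem`, `opB_mem`) — the sub-slot side conditions `hMA`∕`hMB` of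
p217039 are DISCHARGED for all `M` at once (leaf-03's p217231 keeps them as hypotheses).  §1 the re-typed operator-side binders at zero over
`↥M`: `actOpFibre_restrict_zero` (the owner's FIBRE shape for the restricted zero cores, majorant `Aop ≡ 0`, directions IN `M`),
`actOpIntegral_restrict_zero` (the owner's INTEGRAL shape over `↥M`: Dirac measure on `Unit`, integrand `0`, operator domains `univ ⊆ ↥M`),
`actExpNormBound_on_zero` ∕ `actAbsBound_on_zero` (exponent bounds `N ≡ 0` and absolute majorants `A ≡ 0` for leaf-03's `zeroActDataOn` over
ANY operator carrier and ANY class).  §2 for EVERY pair of runs `R`, window `W`, `κ ≥ 0`, prescribed rate `θ′ ∈ (½, 1]` and EVERY `M`: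
**`end_fires_zeroSlots_restrict_secant_structural`**: `NE5 (outA (zeroSlots R) 0 0) (outB (zeroSlots R) 0 0) W κ θ′ 0` THROUGH
`ne5_of_record_restrict_secant_structural (zeroSlots R) M _ _` (the END's constant EVALUATES to `0` at the zero letters; `θ′` is free in
`(½, 1]` — p214898 fixed `θ′ = 1`); **`end_fires_zeroSlots_restrict_secant_integral`** (the `ActOpIntegral`-over-`↥M` END, window `univ`);
**`exists_end_fires_zeroSlots_restrict_secant_lineAnalytic`** (the END reading the Cauchy route's factor datum `ActOpLineAnalyticOn` over `↥M`
+ ROOM + norm majorant — the binder leaf-03's E9[rec]-sub reads too —, `∃ C₅` form); `example`s at `M := ⊤` (R20's «full slot as a sub-slot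
type») and `M := ⊥` (directions `u = 0` only — the degenerate end of «every M»).  Letters as in p214898: `(EA₀, E₀, E₁, cA, cB, c₁, r₀, Gi,
δI, ρ₁, k₁, θ, ρ₀, k₀, B, N̄, ε, εop) = (0,0,1,0,0,0,1,0,0,0,0,½,½,0,0,0,0,0)`, `ω = ½`, `Rt = 64·log 162 + 64`, `ROp ≡ 1`, `RHist ≡ 1`
(`≡ 2` on the line-analytic route, whose ROOM asks `bHist + rHist ≤ RHist`).  So the re-pointed binder list is JOINTLY SATISFIABLE over
every sub-slot TYPE (no clash introduced by R20's re-typing of `hfib`∕`hexp`∕`hN`∕`habs`).  0 sorry; axioms ⊆ {propext, Classical.choice,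
Quot.sound}.
-/

noncomputable section

open MeasureTheory Metric Set
open scoped BigOperators

namespace Summit.QuantumFields.BalabanUV.T4Continuum.B13StepOfRecordSecantStructuralSubWitness

open Literature.MathematicalPhysics.QuantumFieldTheory.Balaban1983to89
open Literature.MathematicalPhysics.QuantumFieldTheory.Balaban1983to89.T4OutputRate (Carriers NE5)
open Literature.MathematicalPhysics.QuantumFieldTheory.Balaban1983to89.T4InputCauchyRateSpecies (ballClass)
open Summit.QuantumFields.BalabanUV.T4Continuum.B13Carriers (TwoRuns)
open Summit.QuantumFields.BalabanUV.T4Continuum.B13OpDatum (OpDatum Format assemble)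
open Summit.QuantumFields.BalabanUV.T4Continuum.B13OpDatumJunctions (opOf)
open Summit.QuantumFields.BalabanUV.T4Continuum.B13StepTermLabels (InnerLabel)
open Summit.QuantumFields.BalabanUV.T4Continuum.B13StepTermFamily (ActData TermIndexing)
open Summit.QuantumFields.BalabanUV.T4Continuum.B13StepTermSocket (labelsIndexing touchInc)
open Summit.QuantumFields.BalabanUV.T4Continuum.B13InnerData (Bnd b13InnerData)
open Summit.QuantumFields.BalabanUV.T4Continuum.B13Base (selfCtr)
open Summit.QuantumFields.BalabanUV.T4Continuum.B13Represents (Assembly)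
open Summit.QuantumFields.BalabanUV.T4Continuum.B13TermHistSecant (ActExpNormBound ActAbsBound)
open Summit.QuantumFields.BalabanUV.T4Continuum.B13DomainGeometryTR (domainGeometry)
open Summit.QuantumFields.BalabanUV.T4Continuum.B13StepOfRecord (Slots assembly step outA outB)
open Summit.QuantumFields.BalabanUV.T4Continuum.B13StepOfRecordSub (assemblyOn stepOn restrict)
open Summit.QuantumFields.BalabanUV.T4Continuum.B13StepEndWitness
open Summit.QuantumFields.BalabanUV.T4Continuum.B13StepOfRecordSecantTermwiseWitness (shape238_zero)
open Summit.QuantumFields.BalabanUV.T4Continuum.B13StepEnvelopeEndSubWitness (zeroActDataOn actExpLinearOn_restrict_zero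
  actOpLineAnalyticOn_restrict_zero actNormBound_restrict_zero)
open Summit.QuantumFields.BalabanUV.T4Continuum.OutputRateActOpFibre (ActOpFibre ActOpIntegral)
open Summit.QuantumFields.BalabanUV.T4Continuum.B13StepOfRecordSecantStructuralSub (ne5_of_record_restrict_secant_structural
  ne5_of_record_restrict_secant_integral ne5_of_record_restrict_secant_lineAnalytic)

/-! ## §0 The zero package's operator data of record lie in EVERY sub-slot -/

section OpData

/-- [folklore] Packaging the zero kernel in any format gives the zero operator datum (both branches of `assemble`). -/
theorem assemble_zero {E : Type*} (F : Format E) : assemble F (fun _ => (0 : ℂ)) = 0 := by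
  unfold assemble
  split_ifs with h
  · exact lp.ext (funext fun e => by simp)
  · rfl

variable {𝔾 : Type} [GaugeGroup 𝔾] (R : TwoRuns 𝔾)

/-- [folklore] Run A's operator data of the zero package vanish at every coupling ∕ background ∕ step. -/
@[simp] theorem opOf_rawA_zero (g : ℕ → ℝ) (V : R.carriers.BgA) (k : ℕ) : opOf (zeroSlots R).F (zeroSlots R).rawA g V k = 0 :=
  assemble_zero _

/-- [folklore] Run B's operator data of the zero package vanish at every coupling ∕ background ∕ step. -/
@[simp] theorem opOf_rawB_zero (g : ℕ → ℝ) (U : R.carriers.BgB) (k : ℕ) : opOf (zeroSlots R).F (zeroSlots R).rawB g U k = 0 :=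
  assemble_zero _

/-- [folklore] Hence run A's operator data of record lie in EVERY ℂ-submodule `M ≤ OpDatum Unit` (p217039's `hMA` for all `M`). -/
theorem opA_mem (M : Submodule ℂ (OpDatum Unit)) : ∀ g V k, opOf (zeroSlots R).F (zeroSlots R).rawA g V k ∈ M :=
  fun g V k => by rw [opOf_rawA_zero]; exact M.zero_mem

/-- [folklore] … and so do run B's (p217039's `hMB` for all `M`). -/
theorem opB_mem (M : Submodule ℂ (OpDatum Unit)) : ∀ g U k, opOf (zeroSlots R).F (zeroSlots R).rawB g U k ∈ M :=
  fun g U k => by rw [opOf_rawB_zero]; exact M.zero_mem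

end OpData

/-! ## §1 The re-typed operator-side and activity-level binders at zero, over a sub-slot -/

section Binders

variable {𝔾 : Type} [GaugeGroup 𝔾] (R : TwoRuns 𝔾) (E₀ cB : ℝ) (W : Set (ℕ → ℝ)) (M : Submodule ℂ (OpDatum Unit))

/-- [folklore] The owner's FIBRE shape for the zero cores RESTRICTED to the sub-slot `M` (directions `u ∈ M`), majorant `Aop ≡ 0`: along every
operator line in `↥M` the restricted zero factor is the constant `0` — complex differentiable and bounded by `0` on the closed unit disc. -/
theorem actOpFibre_restrict_zero :
    ActOpFibre (labelsIndexing (domainGeometry R) (b13InnerData R)) (restrict (zeroSlots R) M (opA_mem R M) (opB_mem R M)).act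
      (stepOn (restrict (zeroSlots R) M (opA_mem R M) (opB_mem R M)) E₀ cB) W fun _ _ _ _ _ => 0 := by
  intro k g _ U p _ X _ i _ m u _
  refine ⟨?_, fun ζ _ => ?_⟩
  · show DifferentiableOn ℂ (fun _ : ℂ => (0 : ℂ)) (closedBall 0 1)
    exact differentiableOn_const 0
  · show ‖(0 : ℂ)‖ ≤ 0
    rw [norm_zero]

/-- [folklore] The owner's INTEGRAL shape OVER `↥M` for the restricted zero cores: at every base point the factor IS `∫ 0 dδ_()` over `Unit`,
holomorphic in the operator datum on `univ ⊆ ↥M`, dominated locally and on the closed operator ball by the zero majorant of mass `0`. -/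
theorem actOpIntegral_restrict_zero :
    ActOpIntegral (labelsIndexing (domainGeometry R) (b13InnerData R)) (restrict (zeroSlots R) M (opA_mem R M) (opB_mem R M)).act
      (stepOn (restrict (zeroSlots R) M (opA_mem R M) (opB_mem R M)) E₀ cB) W (fun _ _ _ _ _ => 0) (α := fun _ _ => Unit)
      (fun _ _ _ _ => Measure.dirac ()) (fun _ _ _ _ _ _ => (0 : ℂ)) fun _ _ _ _ _ _ => Set.univ := by
  intro k g _ U p _ X _ i _ m
  refine ⟨Set.subset_univ _, fun _ _ => aestronglyMeasurable_const, Filter.Eventually.of_forall fun _ => differentiableOn_const 0,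
    fun o₀ _ => ⟨1, one_pos, Set.subset_univ _, fun _ => 0, integrable_zero _ _ _,
      Filter.Eventually.of_forall fun _ _ _ => by rw [norm_zero]⟩,
    ⟨fun _ => 0, integrable_zero _ _ _, Filter.Eventually.of_forall fun _ _ _ => by rw [norm_zero], by simp⟩, fun _ _ => ?_⟩
  show (0 : ℂ) = ∫ _ : Unit, (0 : ℂ) ∂(Measure.dirac ())
  rw [integral_zero]

variable {C : Carriers} (P J Op : Type*)

/-- [folklore] Exponent bounds `N ≡ 0` in any units `r` for leaf-03's zero activity data over ANY operator carrier `Op`, on any class. -/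
theorem actExpNormBound_on_zero {ι : Type*} (𝒯 : TermIndexing C ι P J)
    (K : ℕ → (ℕ → ℝ) → C.BgB → Set (Op × ℂ)) (r : ℕ → ℝ) :
    ActExpNormBound 𝒯 (zeroActDataOn P J Op) K W r fun _ _ _ _ _ => 0 :=
  fun _ _ _ _ _ _ _ _ _ _ _ => Filter.Eventually.of_forall fun _ => by simp [zeroActDataOn]

/-- [folklore] Absolute majorants `A ≡ 0` for leaf-03's zero activity data over ANY operator carrier `Op`, on any class. -/
theorem actAbsBound_on_zero {ι : Type*} (𝒯 : TermIndexing C ι P J)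
    (K : ℕ → (ℕ → ℝ) → C.BgB → Set (Op × ℂ)) :
    ActAbsBound 𝒯 (zeroActDataOn P J Op) K W fun _ _ _ _ _ => 0 :=
  fun _ _ _ _ _ _ _ _ _ _ _ => by simp [zeroActDataOn]

end Binders

/-! ## §2 The re-pointed structural secant ENDs of record FIRE for the zero package on every sub-slot -/

variable {𝔾 : Type} [GaugeGroup 𝔾] (R : TwoRuns 𝔾) (W : Set (ℕ → ℝ))

/-- [folklore] **NON-VACUITY OF E8[rec] RE-POINTED OVER A SUB-SLOT (R20 (i), this lineage's p217039).**  For EVERY pair of runs `R`, window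
`W`, rate `κ ≥ 0`, prescribed `θ′ ∈ (½, 1]` and EVERY ℂ-submodule `M ≤ OpDatum Unit` the hypotheses of
`B13StepOfRecordSecantStructuralSub.ne5_of_record_restrict_secant_structural (zeroSlots R) M _ _` are JOINTLY SATISFIED — sub-slot side
conditions by §0; reading, slice budgets, levels, W1 entry data, the insertion COMPOSITION shape + membership + insertion rate by leaf-10's ∕
this lineage's record-level zero lemmas BY NAME (they are stated on the model of record in the re-pointed END — no transfer needed); **the FIBRE
shape for the RESTRICTED cores over `↥M` (§1)**, **`ActExpLinearOn` for the restricted cores with leaf-03's `zeroActDataOn … M` (p217231)** and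
the exponent ∕ absolute majorants at `0` for it on the sub-slot ball class (§1); both (2.38) shapes at `ε = 0`, rate room
`Rt = 64·log 162 + 64`, radii `ROp ≡ RHist ≡ 1`, numbers `(E₁, r₀, θ, ρ₀, ω) = (1, 1, ½, ½, ½)`, all other letters `0` — so the END
FIRES with root literally on the outputs OF RECORD and its constant evaluates to `0`:
`NE5 (outA (zeroSlots R) 0 0) (outB (zeroSlots R) 0 0) W κ θ′ 0`.  A consistency witness; nothing about [II]'s objects. -/
theorem end_fires_zeroSlots_restrict_secant_structural (M : Submodule ℂ (OpDatum Unit)) {κ θ' : ℝ} (hκ : 0 ≤ κ)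
    (hθ' : 1 / 2 < θ') (hθ'1 : θ' ≤ 1) :
    NE5 (outA (zeroSlots R) 0 0) (outB (zeroSlots R) 0 0) W κ θ' 0 := by
  have h := ne5_of_record_restrict_secant_structural (zeroSlots R) M (opA_mem R M) (opB_mem R M) 0 0 (W := W)
    (ROp := fun _ => 1) (RHist := fun _ => 1)
    (N := fun _ _ _ _ _ => 0) (A := fun _ _ _ _ _ => 0) (A' := fun _ _ _ _ _ => 0)
    (Aop := fun _ _ _ _ _ => 0) (Aop' := fun _ _ _ _ _ => 0)
    (Dt := zeroActDataOn R.carriers.Dom (InnerLabel R.carriers.Dom (Bnd R)) M) (Nbar := 0) (ε := 0) (εop := 0)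
    (Rt := 64 * Real.log 162 + 64) (EA₀ := 0) (E₁ := 1) (cA := 0) (c₁ := 0) (r₀ := 1) (Gi := 0) (δI := 0) (ρ₁ := 0) (θ := 1 / 2)
    (θ' := θ') (ρ₀ := 1 / 2) (B := 0) (k₀ := 0) (k₁ := 0) (fun _ => 1) (fun _ => one_pos)
    (Cfg := fun _ => ℂ) (cfg := fun _ o => o) (Φ := fun _ _ _ => (0 : ℂ)) (𝒪 := fun _ _ _ => Set.univ) (Dc := fun _ _ _ => Set.univ)
    (transportReads_zero R W) (sliceBudgetB_zero R W κ) (sliceBudget_zero R 0 0 W κ) (decayBound_outA_zero R 0 0 W κ)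
    (decayBound_outB_zero R 0 0 W κ) (rawBounded_rawAt_zero R W) (rawBounded_rawB_zero R W)
    (weightedEntrywiseRate_zero R W fun k => (1 / 2 : ℝ) ^ k) (floor_zero R)
    (B13StepOfRecordSecantStructuralWitness.insOpComposition_zero R 0 0 W κ)
    (B13StepOfRecordSecantStructuralWitness.opIA_mem_zero R 0 0 W) (insOpRate_zero R 0 0 W (1 / 2)) le_rfl le_rfl zero_lt_one
    (by norm_num)
    (actOpFibre_restrict_zero R 0 0 W M) (fun _ _ _ _ _ => le_rfl) (fun _ _ _ _ _ => le_rfl) (fun _ _ _ _ _ => by simp) le_rfl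
    (shape238_zero R W _) (by norm_num)
    (actExpLinearOn_restrict_zero R W M (opA_mem R M) (opB_mem R M) _)
    (actExpNormBound_on_zero W _ _ _ _ _ _) (fun _ _ _ _ _ => le_rfl) (fun _ _ _ _ _ => le_rfl) le_rfl
    (actAbsBound_on_zero W _ _ _ _ _) (fun _ _ _ _ _ => le_rfl) (fun _ _ _ _ _ => le_rfl) hκ (fun _ _ _ _ _ => by simp) le_rfl
    (shape238_zero R W _) le_rfl (by norm_num)
    (fun _ => by show (0 : ℝ) / 1 * 1 ≤ 1; norm_num)
    (fun k => by simp [Assembly.bHist])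
    (fun _ => by rw [omega_zero]; show (0 * 0 / (1 - 0) + 2 * 0 / (1 / 2 : ℝ) ^ 0) * 1 + 0 * (1 * (0 / (1 - 1 / 2))) ≤ 1; norm_num)
    le_rfl le_rfl one_pos le_rfl le_rfl le_rfl one_pos (by norm_num) hθ'.le hθ'1 (by rw [omega_zero]; norm_num)
    (by rw [omega_zero]; norm_num) (by norm_num) (by norm_num) (by norm_num) le_rfl
    (fun k hk => absurd hk (Nat.not_lt_zero k))
    (by rw [omega_zero]; norm_num; linarith)
  simp only [zero_mul, mul_zero, zero_div, add_zero] at h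
  exact h

/-- [folklore] **… AND OF THE `ActOpIntegral`-OVER-`↥M` END** (`ne5_of_record_restrict_secant_integral`, the operator side one level down:
each restricted factor a dominated holomorphic parametric integral of the operator datum IN `↥M`): the same data with
`actOpIntegral_restrict_zero` in place of `actOpFibre_restrict_zero`, on the full window `Set.univ`:
`NE5 (outA (zeroSlots R) 0 0) (outB (zeroSlots R) 0 0) univ κ θ′ 0` for every `M`. -/
theorem end_fires_zeroSlots_restrict_secant_integral (M : Submodule ℂ (OpDatum Unit)) {κ θ' : ℝ} (hκ : 0 ≤ κ)
    (hθ' : 1 / 2 < θ') (hθ'1 : θ' ≤ 1) :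
    NE5 (outA (zeroSlots R) 0 0) (outB (zeroSlots R) 0 0) Set.univ κ θ' 0 := by
  have h := ne5_of_record_restrict_secant_integral (zeroSlots R) M (opA_mem R M) (opB_mem R M) 0 0 (W := Set.univ)
    (ROp := fun _ => 1) (RHist := fun _ => 1)
    (N := fun _ _ _ _ _ => 0) (A := fun _ _ _ _ _ => 0) (A' := fun _ _ _ _ _ => 0)
    (Aop := fun _ _ _ _ _ => 0) (Aop' := fun _ _ _ _ _ => 0)
    (Dt := zeroActDataOn R.carriers.Dom (InnerLabel R.carriers.Dom (Bnd R)) M) (Nbar := 0) (ε := 0) (εop := 0)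
    (Rt := 64 * Real.log 162 + 64) (EA₀ := 0) (E₁ := 1) (cA := 0) (c₁ := 0) (r₀ := 1) (Gi := 0) (δI := 0) (ρ₁ := 0) (θ := 1 / 2)
    (θ' := θ') (ρ₀ := 1 / 2) (B := 0) (k₀ := 0) (k₁ := 0) (fun _ => 1) (fun _ => one_pos)
    (Cfg := fun _ => ℂ) (cfg := fun _ o => o) (Φ := fun _ _ _ => (0 : ℂ)) (𝒪 := fun _ _ _ => Set.univ) (Dc := fun _ _ _ => Set.univ)
    (transportReads_zero R Set.univ) (sliceBudgetB_zero R Set.univ κ) (sliceBudget_zero R 0 0 Set.univ κ)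
    (decayBound_outA_zero R 0 0 Set.univ κ) (decayBound_outB_zero R 0 0 Set.univ κ) (rawBounded_rawAt_zero R Set.univ)
    (rawBounded_rawB_zero R Set.univ) (weightedEntrywiseRate_zero R Set.univ fun k => (1 / 2 : ℝ) ^ k) (floor_zero R)
    (B13StepOfRecordSecantStructuralWitness.insOpComposition_zero R 0 0 Set.univ κ)
    (B13StepOfRecordSecantStructuralWitness.opIA_mem_zero R 0 0 Set.univ) (insOpRate_zero R 0 0 Set.univ (1 / 2)) le_rfl le_rfl
    zero_lt_one (by norm_num)
    (α := fun _ _ => Unit) (μ := fun _ _ _ _ => Measure.dirac ()) (f := fun _ _ _ _ _ _ => (0 : ℂ)) (𝒪op := fun _ _ _ _ _ _ => Set.univ)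
    (actOpIntegral_restrict_zero R 0 0 Set.univ M) (fun _ _ _ _ _ => le_rfl) (fun _ _ _ _ _ => le_rfl) (fun _ _ _ _ _ => by simp)
    le_rfl (shape238_zero R Set.univ _) (by norm_num)
    (actExpLinearOn_restrict_zero R Set.univ M (opA_mem R M) (opB_mem R M) _)
    (actExpNormBound_on_zero Set.univ _ _ _ _ _ _) (fun _ _ _ _ _ => le_rfl) (fun _ _ _ _ _ => le_rfl) le_rfl
    (actAbsBound_on_zero Set.univ _ _ _ _ _) (fun _ _ _ _ _ => le_rfl) (fun _ _ _ _ _ => le_rfl) hκ (fun _ _ _ _ _ => by simp)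
    le_rfl (shape238_zero R Set.univ _) le_rfl (by norm_num)
    (fun _ => by show (0 : ℝ) / 1 * 1 ≤ 1; norm_num)
    (fun k => by simp [Assembly.bHist])
    (fun _ => by rw [omega_zero]; show (0 * 0 / (1 - 0) + 2 * 0 / (1 / 2 : ℝ) ^ 0) * 1 + 0 * (1 * (0 / (1 - 1 / 2))) ≤ 1; norm_num)
    le_rfl le_rfl one_pos le_rfl le_rfl le_rfl one_pos (by norm_num) hθ'.le hθ'1 (by rw [omega_zero]; norm_num)
    (by rw [omega_zero]; norm_num) (by norm_num) (by norm_num) (by norm_num) le_rfl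
    (fun k hk => absurd hk (Nat.not_lt_zero k))
    (by rw [omega_zero]; norm_num; linarith)
  simp only [zero_mul, mul_zero, zero_div, add_zero] at h
  exact h

/-- [folklore] **… AND OF THE END READING THE CAUCHY ROUTE's FACTOR DATUM OVER `↥M`** (`ne5_of_record_restrict_secant_lineAnalytic`: ROOM
`rOp ≤ ROp`, `bHist + rHist ≤ RHist` — here `ROp ≡ 1`, `RHist ≡ 2` —, the activity NORM majorant `Aop ≡ 0` of the restricted cores on the
sub-slot ball class (leaf-03's `actNormBound_restrict_zero`) and `ActOpLineAnalyticOn` for the restricted cores over `↥M` (leaf-03's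
`actOpLineAnalyticOn_restrict_zero`) — the ONE operator binder E8[rec] and E9[rec]-sub now share): for every `M`, `κ ≥ 0` and
`θ′ ∈ (½, 1]`, `∃ C₅, NE5 (outA (zeroSlots R) 0 0) (outB (zeroSlots R) 0 0) W κ θ′ C₅` (the witness constant is again `0`). -/
theorem exists_end_fires_zeroSlots_restrict_secant_lineAnalytic (M : Submodule ℂ (OpDatum Unit)) {κ θ' : ℝ} (hκ : 0 ≤ κ)
    (hθ' : 1 / 2 < θ') (hθ'1 : θ' ≤ 1) :
    ∃ C₅, NE5 (outA (zeroSlots R) 0 0) (outB (zeroSlots R) 0 0) W κ θ' C₅ :=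
  ⟨_, ne5_of_record_restrict_secant_lineAnalytic (zeroSlots R) M (opA_mem R M) (opB_mem R M) 0 0 (W := W)
    (ROp := fun _ => 1) (RHist := fun _ => 2)
    (N := fun _ _ _ _ _ => 0) (A := fun _ _ _ _ _ => 0) (A' := fun _ _ _ _ _ => 0)
    (Aop := fun _ _ _ _ _ => 0) (Aop' := fun _ _ _ _ _ => 0)
    (Dt := zeroActDataOn R.carriers.Dom (InnerLabel R.carriers.Dom (Bnd R)) M) (Nbar := 0) (ε := 0) (εop := 0)
    (Rt := 64 * Real.log 162 + 64) (EA₀ := 0) (E₁ := 1) (cA := 0) (c₁ := 0) (r₀ := 1) (Gi := 0) (δI := 0) (ρ₁ := 0) (θ := 1 / 2)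
    (θ' := θ') (ρ₀ := 1 / 2) (B := 0) (k₀ := 0) (k₁ := 0) (fun _ => 1) (fun _ => one_pos)
    (Cfg := fun _ => ℂ) (cfg := fun _ o => o) (Φ := fun _ _ _ => (0 : ℂ)) (𝒪 := fun _ _ _ => Set.univ) (Dc := fun _ _ _ => Set.univ)
    (transportReads_zero R W) (sliceBudgetB_zero R W κ) (sliceBudget_zero R 0 0 W κ) (decayBound_outA_zero R 0 0 W κ)
    (decayBound_outB_zero R 0 0 W κ) (rawBounded_rawAt_zero R W) (rawBounded_rawB_zero R W)
    (weightedEntrywiseRate_zero R W fun k => (1 / 2 : ℝ) ^ k) (floor_zero R)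
    (B13StepOfRecordSecantStructuralWitness.insOpComposition_zero R 0 0 W κ)
    (B13StepOfRecordSecantStructuralWitness.opIA_mem_zero R 0 0 W) (insOpRate_zero R 0 0 W (1 / 2)) le_rfl le_rfl zero_lt_one
    (by norm_num)
    (fun _ => le_rfl) (fun _ => by show (0 : ℝ) * (1 * (0 / (1 - 1 / 2))) + 1 ≤ 2; norm_num)
    (actNormBound_restrict_zero R W M _) (actOpLineAnalyticOn_restrict_zero R W M (opA_mem R M) (opB_mem R M) _)
    (fun _ _ _ _ _ => le_rfl) (fun _ _ _ _ _ => le_rfl) (fun _ _ _ _ _ => by simp) le_rfl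
    (shape238_zero R W _) (by norm_num)
    (actExpLinearOn_restrict_zero R W M (opA_mem R M) (opB_mem R M) _)
    (actExpNormBound_on_zero W _ _ _ _ _ _) (fun _ _ _ _ _ => le_rfl) (fun _ _ _ _ _ => le_rfl) le_rfl
    (actAbsBound_on_zero W _ _ _ _ _) (fun _ _ _ _ _ => le_rfl) (fun _ _ _ _ _ => le_rfl) hκ (fun _ _ _ _ _ => by simp) le_rfl
    (shape238_zero R W _) le_rfl (by norm_num)
    (fun _ => by show (0 : ℝ) / 1 * 1 ≤ 1; norm_num)
    (fun k => by simp [Assembly.bHist])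
    (fun _ => by rw [omega_zero]; show (0 * 0 / (1 - 0) + 2 * 0 / (1 / 2 : ℝ) ^ 0) * 1 + 0 * (1 * (0 / (1 - 1 / 2))) ≤ 2; norm_num)
    le_rfl le_rfl one_pos le_rfl le_rfl le_rfl one_pos (by norm_num) hθ'.le hθ'1 (by rw [omega_zero]; norm_num)
    (by rw [omega_zero]; norm_num) (by norm_num) (by norm_num) (by norm_num) le_rfl
    (fun k hk => absurd hk (Nat.not_lt_zero k))
    (by rw [omega_zero]; norm_num; linarith)⟩

/-- [folklore] **THE FULL SLOT AS A SUB-SLOT TYPE** (`M := ⊤`, R20's operator carrier shape): the re-pointed structural END fires with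
every binder living on `↥⊤ × ℂ`, root on the outputs of record. -/
example {κ θ' : ℝ} (hκ : 0 ≤ κ) (hθ' : 1 / 2 < θ') (hθ'1 : θ' ≤ 1) :
    NE5 (outA (zeroSlots R) 0 0) (outB (zeroSlots R) 0 0) W κ θ' 0 :=
  end_fires_zeroSlots_restrict_secant_structural R W ⊤ hκ hθ' hθ'1

/-- [folklore] **THE ZERO SUB-SLOT** (`M := ⊥`, operator directions `u = 0` only): the degenerate end of «every `M`» — the re-pointed END's
binder list is satisfiable even when the operator-line binder quantifies over the trivial direction alone. -/
example {κ θ' : ℝ} (hκ : 0 ≤ κ) (hθ' : 1 / 2 < θ') (hθ'1 : θ' ≤ 1) :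
    NE5 (outA (zeroSlots R) 0 0) (outB (zeroSlots R) 0 0) W κ θ' 0 :=
  end_fires_zeroSlots_restrict_secant_structural R W ⊥ hκ hθ' hθ'1

end Summit.QuantumFields.BalabanUV.T4Continuum.B13StepOfRecordSecantStructuralSubWitness

end
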